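import Summits.CriticalPhenomena.PercolationContinuityZ3.Theorems.PercBudgetLadderPinholeClosingPocketKill
import Summits.CriticalPhenomena.PercolationContinuityZ3.Theorems.PercBudgetLadderPinholeClosingStubLeverArithmetic
import HarnessLib

/-!
# Pocket resampling for `PercBudgetLadder.PinholeClosing` (stmt-CriticalPhenomena-5249) — the certified reduction to the bet

`Theorems.stub_pocketReduction` (registered, def-free): **if** the liveness mass has a second moment bounded uniformly in `n`
at every budget level `k` and aspect `l ≥ 2` (`SecondMomentLiveness`, the line's single OPEN bet — not asserted here), **then**
`PercBudgetLadder.PinholeClosing` holds, with `c' = min(c/2, qc/4, (qc/4)²/max(K,1))`, `q = (1-p_c)^5`.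
`Theorems.stub_pocketReductionUI` (registered, def-free): the same from the WEAKER hypothesis of uniform integrability
(`∫_{D > K} D ≤ ε` uniformly in `n`), with `c' = min(c/2, qc/4, qc/(8 max(K,1)))`, `K = K(k,l,qc/8)` (`levelStep_of_uniformIntegrable`,
tail splitting `setIntegral_le_of_tail`).
Chain (`levelStep_of_secondMoment`): dichotomy `P(bEv k n ln) ≥ c/2` or `P(exact) ≥ c/2`; kill inequality
(`PocketResampling.kill_inequality`); split `∫_F D` along `{D ≤ 1}` and `{D > 1} ⊆ bEv k n (ln)` a.s.
(`ae_mem_bEv_of_one_lt_livenessMass`); Cauchy–Schwarz (`Theorems.stub_leverArithmetic`); aspect monotonicity.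
Status of the hypothesis: numerically supported at `k = 0` (kit j015366, ideator 5: `E[D² | M=0]` saturates in `n` at
l = 4, 6, 8); open; plausibly false for `d > 6`; its failure would not refute the crux (it is a sufficient condition only).
-/

noncomputable section

namespace Summit.CriticalPhenomena.PercolationContinuityZ3.Theorems

open MeasureTheory Finset
open Literature.Probability.Percolation Literature.Probability.LatticeModels
open Summit.CriticalPhenomena.PercolationContinuityZ3.Theses
open Summit.CriticalPhenomena.PercolationContinuityZ3.Theorems.PinholeClosing.Negative
open scoped Classical

namespace PocketResampling

/-- **Lever bookkeeping.**  For `l ≥ 2`, `n ≥ 1`, with `D = livenessMass k n (ln)`: (i) `D` is measurable, (ii) `0 ≤ D ≤ 2^{#box(ln)}`,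
(iii) `{D > 1} ⊆ bEv k n (ln)` a.s. (two distinct tight pockets), (iv) the kill inequality
`q · P(exact) ≤ ∫_{bEv k n (2ln)} D` (disintegration per pocket + door kill + the identity `E[D] = P(exact)`). -/
theorem leverBookkeeping :
    ∀ (k n l : ℕ), 2 ≤ l → 1 ≤ n →
      Measurable (livenessMass k n (l * n)) ∧
      (∀ ω, 0 ≤ livenessMass k n (l * n) ω ∧ livenessMass k n (l * n) ω ≤ (2 : ℝ) ^ (box 3 (l * n)).card) ∧
      (∀ᵐ ω ∂μc, 1 < livenessMass k n (l * n) ω → ω ∈ bEv k n (l * n)) ∧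
      qKill * μc.real (exactEv k n (l * n)) ≤ ∫ ω in bEv k n (2 * l * n), livenessMass k n (l * n) ω ∂μc := by
  intro k n l hl hn
  exact ⟨measurable_livenessMass k n (l * n),
    fun ω => ⟨livenessMass_nonneg k n (l * n) ω, livenessMass_le k n (l * n) ω⟩,
    ae_mem_bEv_of_one_lt_livenessMass k n (l * n), kill_inequality hl hn⟩

/-- `q = (1 - p_c)^5 > 0`. -/
theorem qKill_pos : 0 < qKill := by
  unfold qKill
  have := pc_lt_one
  positivity

/-- Budget monotonicity `bEv k ⊆ bEv (k+1)`. -/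
theorem bEv_subset_succ (k n m : ℕ) : bEv k n m ⊆ bEv (k + 1) n m :=
  blockedEv_mono_budget (Nat.le_succ k) n m

/-- `P(bEv (k+1)) = P(bEv k) + P(exact)`. -/
theorem real_bEv_succ (k n m : ℕ) :
    μc.real (bEv (k + 1) n m) = μc.real (bEv k n m) + μc.real (exactEv k n m) := by
  have hunion : bEv (k + 1) n m = bEv k n m ∪ exactEv k n m := by
    rw [exactEv, Set.union_sdiff_cancel (bEv_subset_succ k n m)]
  have hdisj : Disjoint (bEv k n m) (exactEv k n m) := Set.disjoint_sdiff_right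
  rw [hunion, measureReal_union hdisj ((measurableSet_blockedEv (k + 1) n m).diff (measurableSet_blockedEv k n m))]

/-- **Level `k` of the crux from a second-moment bound** (same-shape dichotomy + kill + Cauchy–Schwarz). -/
theorem levelStep_of_secondMoment (k l : ℕ) (c : ℝ) (hl : 2 ≤ l) (hc : 0 < c)
    (hK : ∃ K : ℝ, ∀ n : ℕ, 1 ≤ n → ∫ ω, (livenessMass k n (l * n) ω) ^ 2 ∂μc ≤ K) :
    ∃ c' : ℝ, 0 < c' ∧ ∀ n : ℕ, 1 ≤ n →
      c ≤ μc.real (bEv (k + 1) n (l * n)) → c' ≤ μc.real (bEv k n (2 * l * n)) := by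
  obtain ⟨K, hK⟩ := hK
  set K' : ℝ := max K 1 with hK'
  have hK'pos : 0 < K' := lt_of_lt_of_le one_pos (le_max_right _ _)
  set q : ℝ := qKill with hq
  have hqpos : 0 < q := qKill_pos
  refine ⟨min (c / 2) (min (q * c / 4) ((q * c / 4) ^ 2 / K')), ?_, ?_⟩
  · have h1 : 0 < q * c / 4 := by positivity
    have h2 : 0 < (q * c / 4) ^ 2 / K' := by positivity
    exact lt_min (by linarith) (lt_min h1 h2)
  intro n hn hprem
  obtain ⟨hmeas, hbdd, hD1, hkill⟩ := leverBookkeeping k n l hl hn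
  -- notation
  set P₀ : ℝ := μc.real (bEv k n (l * n)) with hP₀
  set P₂ : ℝ := μc.real (bEv k n (2 * l * n)) with hP₂
  set m₁ : ℝ := μc.real (exactEv k n (l * n)) with hm₁
  have hP₀P₂ : P₀ ≤ P₂ := blockProb_mono_aspect (k := k) (by nlinarith) (by nlinarith)
  have hsplit : μc.real (bEv (k + 1) n (l * n)) = P₀ + m₁ := real_bEv_succ k n (l * n)
  have hP₀nn : 0 ≤ P₀ := measureReal_nonneg
  -- the arithmetic stub with D = livenessMass, F = bEv k n (2ln), G = bEv k n (ln)
  have hKn : ∫ ω, (livenessMass k n (l * n) ω) ^ 2 ∂μc ≤ K' := (hK n hn).trans (le_max_left _ _)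
  have harith := stub_leverArithmetic (livenessMass k n (l * n)) (bEv k n (2 * l * n)) (bEv k n (l * n)) K'
    ((2 : ℝ) ^ (box 3 (l * n)).card) hmeas (fun ω => (hbdd ω).1) (fun ω => (hbdd ω).2)
    (measurableSet_blockedEv k n (2 * l * n)) (measurableSet_blockedEv k n (l * n)) hD1 hKn
  -- so: q m₁ ≤ P₂ + √(K' P₀)
  have hmain : q * m₁ ≤ P₂ + Real.sqrt (K' * P₀) := hkill.trans harith
  by_cases hcase : c / 2 ≤ P₀
  · have hmin : min (c / 2) (min (q * c / 4) ((q * c / 4) ^ 2 / K')) ≤ c / 2 := min_le_left _ _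
    exact hmin.trans (hcase.trans hP₀P₂)
  · push Not at hcase
    have hm₁ : c / 2 ≤ m₁ := by linarith only [hcase, hprem, hsplit]
    have hqm : q * c / 2 ≤ q * m₁ := by nlinarith only [hm₁, hqpos]
    by_cases hcase2 : (q * c / 4) ^ 2 / K' ≤ P₀
    · have hmin : min (c / 2) (min (q * c / 4) ((q * c / 4) ^ 2 / K')) ≤ (q * c / 4) ^ 2 / K' :=
        (min_le_right _ _).trans (min_le_right _ _)
      exact hmin.trans (hcase2.trans hP₀P₂)
    · push Not at hcase2
      -- √(K' P₀) < q c / 4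
      have hsqrt : Real.sqrt (K' * P₀) < q * c / 4 := by
        have hlt : K' * P₀ < (q * c / 4) ^ 2 := by
          have := (lt_div_iff₀ hK'pos).1 hcase2
          linarith only [this]
        have hqc : 0 ≤ q * c / 4 := by positivity
        calc Real.sqrt (K' * P₀) < Real.sqrt ((q * c / 4) ^ 2) :=
              Real.sqrt_lt_sqrt (mul_nonneg hK'pos.le hP₀nn) hlt
          _ = q * c / 4 := Real.sqrt_sq hqc
      have hfin : q * c / 4 ≤ P₂ := by linarith only [hmain, hqm, hsqrt]
      have hmin : min (c / 2) (min (q * c / 4) ((q * c / 4) ^ 2 / K')) ≤ q * c / 4 :=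
        (min_le_right _ _).trans (min_le_left _ _)
      exact hmin.trans hfin


/-! ### §3b The reduction from UNIFORM INTEGRABILITY of the liveness mass (weaker than a second moment) -/

/-- Tail splitting: for `0 ≤ D` measurable and bounded, `{D > 1} ⊆ G` a.s. and `K ≥ 1`:
`∫_F D ≤ P(F) + K·P(G) + ∫_{D > K} D`. -/
theorem setIntegral_le_of_tail {D : BondConfig (Site 3) → ℝ} {F G : Set (BondConfig (Site 3))} {K B : ℝ}
    (hDm : Measurable D) (hD0 : ∀ ω, 0 ≤ D ω) (hDB : ∀ ω, D ω ≤ B) (hF : MeasurableSet F) (hG : MeasurableSet G)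
    (hDG : ∀ᵐ ω ∂μc, 1 < D ω → ω ∈ G) (hK : 1 ≤ K) :
    ∫ ω in F, D ω ∂μc ≤ μc.real F + K * μc.real G + ∫ ω in {ω | K < D ω}, D ω ∂μc := by
  have hT : MeasurableSet {ω : BondConfig (Site 3) | K < D ω} := measurableSet_lt measurable_const hDm
  have hint : ∀ {s : Set (BondConfig (Site 3))}, MeasurableSet s → Integrable (s.indicator D) μc := by
    intro s hs
    refine (Integrable.of_bound (hDm.aestronglyMeasurable) B (ae_of_all _ fun ω => ?_)).indicator hs
    rw [Real.norm_eq_abs, abs_of_nonneg (hD0 ω)]; exact hDB ω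
  -- pointwise a.e.: D·𝟙_F ≤ 𝟙_F + K·𝟙_G + D·𝟙_{D > K}
  have hpt : ∀ᵐ ω ∂μc, F.indicator D ω ≤
      F.indicator (fun _ => (1 : ℝ)) ω + K * G.indicator (fun _ => (1 : ℝ)) ω + {ω | K < D ω}.indicator D ω := by
    filter_upwards [hDG] with ω hω
    by_cases hωF : ω ∈ F
    · rw [Set.indicator_of_mem hωF, Set.indicator_of_mem hωF]
      by_cases h1 : D ω ≤ 1
      · have hG0 : 0 ≤ K * G.indicator (fun _ => (1 : ℝ)) ω :=
          mul_nonneg (by linarith) (Set.indicator_nonneg (fun _ _ => zero_le_one) ω)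
        have hT0 : 0 ≤ {ω | K < D ω}.indicator D ω := Set.indicator_nonneg (fun ω _ => hD0 ω) ω
        linarith
      · push Not at h1
        have hωG : ω ∈ G := hω h1
        rw [Set.indicator_of_mem hωG, mul_one]
        by_cases hK' : K < D ω
        · rw [Set.indicator_of_mem (show ω ∈ {ω | K < D ω} from hK')]
          linarith
        · rw [Set.indicator_of_notMem (show ω ∉ {ω | K < D ω} from hK')]
          push Not at hK'
          linarith
    · rw [Set.indicator_of_notMem hωF, Set.indicator_of_notMem hωF]
      have hG0 : 0 ≤ K * G.indicator (fun _ => (1 : ℝ)) ω :=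
        mul_nonneg (by linarith) (Set.indicator_nonneg (fun _ _ => zero_le_one) ω)
      have hT0 : 0 ≤ {ω | K < D ω}.indicator D ω := Set.indicator_nonneg (fun ω _ => hD0 ω) ω
      linarith
  have hI1 : Integrable (fun ω => F.indicator (fun _ => (1 : ℝ)) ω) μc := (integrable_const 1).indicator hF
  have hI2 : Integrable (fun ω => K * G.indicator (fun _ => (1 : ℝ)) ω) μc :=
    ((integrable_const 1).indicator hG).const_mul K
  have hI3 : Integrable (fun ω => {ω | K < D ω}.indicator D ω) μc := hint hT
  have hI12 : Integrable (fun ω => F.indicator (fun _ => (1 : ℝ)) ω + K * G.indicator (fun _ => (1 : ℝ)) ω) μc :=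
    hI1.add hI2
  have hI123 : Integrable (fun ω => F.indicator (fun _ => (1 : ℝ)) ω + K * G.indicator (fun _ => (1 : ℝ)) ω +
      {ω | K < D ω}.indicator D ω) μc := hI12.add hI3
  have hmono := integral_mono_ae (hint hF) hI123 hpt
  have e1 := integral_add hI12 hI3
  have e2 := integral_add hI1 hI2
  beta_reduce at hmono e1 e2
  have e3' : ∫ ω, G.indicator (fun _ => (1 : ℝ)) ω ∂μc = μc.real G := integral_indicator_one hG
  have e3 : ∫ ω, K * G.indicator (fun _ => (1 : ℝ)) ω ∂μc = K * μc.real G := by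
    rw [integral_const_mul, e3']
  have e4 : ∫ ω, F.indicator (fun _ => (1 : ℝ)) ω ∂μc = μc.real F := integral_indicator_one hF
  have e5 : ∫ ω, {ω | K < D ω}.indicator D ω ∂μc = ∫ ω in {ω | K < D ω}, D ω ∂μc := integral_indicator hT
  have e6 : ∫ ω, F.indicator D ω ∂μc = ∫ ω in F, D ω ∂μc := integral_indicator hF
  linarith [hmono, e1, e2, e3, e4, e5, e6]

/-- **Level `k` of the crux from UNIFORM INTEGRABILITY of the liveness mass** (`∫_{D > K} D ≤ ε` uniformly in `n`):
`c' = min(c/2, qc/4, qc/(8·max(K,1)))` with `K = K(k, l, qc/8)`. -/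
theorem levelStep_of_uniformIntegrable (k l : ℕ) (c : ℝ) (hl : 2 ≤ l) (hc : 0 < c)
    (hUI : ∀ ε : ℝ, 0 < ε → ∃ K : ℝ, ∀ n : ℕ, 1 ≤ n →
      ∫ ω in {ω | K < livenessMass k n (l * n) ω}, livenessMass k n (l * n) ω ∂μc ≤ ε) :
    ∃ c' : ℝ, 0 < c' ∧ ∀ n : ℕ, 1 ≤ n →
      c ≤ μc.real (bEv (k + 1) n (l * n)) → c' ≤ μc.real (bEv k n (2 * l * n)) := by
  set q : ℝ := qKill with hq
  have hqpos : 0 < q := qKill_pos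
  obtain ⟨K, hK⟩ := hUI (q * c / 8) (by positivity)
  set K' : ℝ := max K 1 with hK'
  have hK'1 : 1 ≤ K' := le_max_right _ _
  have hK'pos : 0 < K' := lt_of_lt_of_le one_pos hK'1
  refine ⟨min (c / 2) (min (q * c / 4) (q * c / (8 * K'))), ?_, ?_⟩
  · have h1 : 0 < q * c / 4 := by positivity
    have h2 : 0 < q * c / (8 * K') := by positivity
    exact lt_min (by linarith) (lt_min h1 h2)
  intro n hn hprem
  obtain ⟨hmeas, hbdd, hD1, hkill⟩ := leverBookkeeping k n l hl hn
  set P₀ : ℝ := μc.real (bEv k n (l * n)) with hP₀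
  set P₂ : ℝ := μc.real (bEv k n (2 * l * n)) with hP₂
  set m₁ : ℝ := μc.real (exactEv k n (l * n)) with hm₁
  have hP₀P₂ : P₀ ≤ P₂ := blockProb_mono_aspect (k := k) (by nlinarith) (by nlinarith)
  have hsplit : μc.real (bEv (k + 1) n (l * n)) = P₀ + m₁ := real_bEv_succ k n (l * n)
  have hP₀nn : 0 ≤ P₀ := measureReal_nonneg
  -- the tail beyond K' is at most the tail beyond K
  have htail : ∫ ω in {ω | K' < livenessMass k n (l * n) ω}, livenessMass k n (l * n) ω ∂μc ≤ q * c / 8 := by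
    refine le_trans ?_ (hK n hn)
    apply setIntegral_mono_set
    · refine Integrable.integrableOn (Integrable.of_bound hmeas.aestronglyMeasurable ((2 : ℝ) ^ (box 3 (l * n)).card)
        (ae_of_all _ fun ω => ?_))
      rw [Real.norm_eq_abs, abs_of_nonneg (hbdd ω).1]; exact (hbdd ω).2
    · exact ae_of_all _ fun ω => (hbdd ω).1
    · exact ae_of_all _ fun ω (hω : K' < livenessMass k n (l * n) ω) =>
        show K < livenessMass k n (l * n) ω from lt_of_le_of_lt (le_max_left K 1) hω
  have harith := setIntegral_le_of_tail (F := bEv k n (2 * l * n)) (G := bEv k n (l * n)) hmeas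
    (fun ω => (hbdd ω).1) (fun ω => (hbdd ω).2) (measurableSet_blockedEv k n (2 * l * n))
    (measurableSet_blockedEv k n (l * n)) hD1 hK'1
  have hmain : q * m₁ ≤ P₂ + K' * P₀ + q * c / 8 := hkill.trans (harith.trans (by linarith))
  by_cases hcase : c / 2 ≤ P₀
  · exact (min_le_left _ _).trans (hcase.trans hP₀P₂)
  · push Not at hcase
    have hm₁ : c / 2 ≤ m₁ := by linarith only [hcase, hprem, hsplit]
    have hqm : q * c / 2 ≤ q * m₁ := by nlinarith only [hm₁, hqpos]
    by_cases hcase2 : q * c / (8 * K') ≤ P₀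
    · exact ((min_le_right _ _).trans (min_le_right _ _)).trans (hcase2.trans hP₀P₂)
    · push Not at hcase2
      have hKP : K' * P₀ < q * c / 8 := by
        have := (lt_div_iff₀ (by positivity : (0 : ℝ) < 8 * K')).1 hcase2
        nlinarith only [this, hK'pos]
      have hfin : q * c / 4 ≤ P₂ := by linarith only [hmain, hqm, hKP]
      exact ((min_le_right _ _).trans (min_le_left _ _)).trans hfin



/-! ### §3c The crux's level `k` is EQUIVALENT to a uniform conditional-mean bound for the liveness mass

Honest calibration of the line: by the kill inequality (⇐, no Cauchy–Schwarz needed) and by `∫ D ≤ 1` (⇒, trivial), level `k`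
of the crux at aspect `l` is equivalent to "under the premise, `∫_{bEv k n 2ln} D ≤ K · P(bEv k n 2ln)` uniformly in `n`".  So the
L² / UI bets are STRENGTHENINGS of the crux's own conclusion recast as moment bounds of one functional — their only advantage is
that `E[D²]` is a three-replica quantity (pairs of pockets revived by independent exteriors) that can be estimated without knowing the
blocked probability. -/

/-- `∫_G D ≤ 1` for every event `G` (from `D ≥ 0` and the liveness identity `∫ D = P(exact) ≤ 1`). -/
theorem setIntegral_livenessMass_le_one {k n l : ℕ} (hl : 2 ≤ l) (hn : 1 ≤ n) (G : Set (BondConfig (Site 3))) :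
    ∫ ω in G, livenessMass k n (l * n) ω ∂μc ≤ 1 := by
  have hint : Integrable (livenessMass k n (l * n)) μc := by
    refine Integrable.of_bound (measurable_livenessMass k n (l * n)).aestronglyMeasurable
      ((2 : ℝ) ^ (box 3 (l * n)).card) (ae_of_all _ fun ω => ?_)
    rw [Real.norm_eq_abs, abs_of_nonneg (livenessMass_nonneg k n (l * n) ω)]
    exact livenessMass_le k n (l * n) ω
  calc ∫ ω in G, livenessMass k n (l * n) ω ∂μc ≤ ∫ ω, livenessMass k n (l * n) ω ∂μc :=
        setIntegral_le_integral hint (ae_of_all _ fun ω => livenessMass_nonneg k n (l * n) ω)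
    _ = μc.real (exactEv k n (l * n)) := integral_livenessMass_eq (lt_mul_of_two_le hl hn)
    _ ≤ 1 := measureReal_le_one

/-- **Level `k` of the crux at aspect `l` ⟺ a uniform bound on the conditional mean of the liveness mass on the doubled
blocked event** (under the premise).  `⇐`: dichotomy + kill inequality; `⇒`: `∫_G D ≤ 1 ≤ P(G)/c'`. -/
theorem levelStep_iff_condMean (k l : ℕ) (hl : 2 ≤ l) :
    (∀ c : ℝ, 0 < c → ∃ c' : ℝ, 0 < c' ∧ ∀ n : ℕ, 1 ≤ n →
        c ≤ μc.real (bEv (k + 1) n (l * n)) → c' ≤ μc.real (bEv k n (2 * l * n))) ↔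
    (∀ c : ℝ, 0 < c → ∃ K : ℝ, ∀ n : ℕ, 1 ≤ n → c ≤ μc.real (bEv (k + 1) n (l * n)) →
        ∫ ω in bEv k n (2 * l * n), livenessMass k n (l * n) ω ∂μc ≤ K * μc.real (bEv k n (2 * l * n))) := by
  constructor
  · intro h c hc
    obtain ⟨c', hc', H⟩ := h c hc
    refine ⟨1 / c', fun n hn hprem => ?_⟩
    have hP : c' ≤ μc.real (bEv k n (2 * l * n)) := H n hn hprem
    have h1 : ∫ ω in bEv k n (2 * l * n), livenessMass k n (l * n) ω ∂μc ≤ 1 :=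
      setIntegral_livenessMass_le_one hl hn _
    have h2 : 1 ≤ 1 / c' * μc.real (bEv k n (2 * l * n)) := by
      rw [div_mul_eq_mul_div, one_mul, le_div_iff₀ hc']; linarith
    linarith
  · intro h c hc
    obtain ⟨K, hK⟩ := h c hc
    set K' : ℝ := max K 1 with hK'
    have hK'pos : 0 < K' := lt_of_lt_of_le one_pos (le_max_right _ _)
    set q : ℝ := qKill with hq
    have hqpos : 0 < q := qKill_pos
    refine ⟨min (c / 2) (q * c / (2 * K')), lt_min (by linarith) (by positivity), fun n hn hprem => ?_⟩
    obtain ⟨-, -, -, hkill⟩ := leverBookkeeping k n l hl hn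
    set P₀ : ℝ := μc.real (bEv k n (l * n)) with hP₀
    set P₂ : ℝ := μc.real (bEv k n (2 * l * n)) with hP₂
    set m₁ : ℝ := μc.real (exactEv k n (l * n)) with hm₁
    have hP₀P₂ : P₀ ≤ P₂ := blockProb_mono_aspect (k := k) (by nlinarith) (by nlinarith)
    have hsplit : μc.real (bEv (k + 1) n (l * n)) = P₀ + m₁ := real_bEv_succ k n (l * n)
    have hP₂nn : 0 ≤ P₂ := measureReal_nonneg
    have hKn : ∫ ω in bEv k n (2 * l * n), livenessMass k n (l * n) ω ∂μc ≤ K' * P₂ :=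
      (hK n hn hprem).trans (mul_le_mul_of_nonneg_right (le_max_left _ _) hP₂nn)
    have hmain : q * m₁ ≤ K' * P₂ := hkill.trans hKn
    by_cases hcase : c / 2 ≤ P₀
    · exact (min_le_left _ _).trans (hcase.trans hP₀P₂)
    · push Not at hcase
      have hm₁ : c / 2 ≤ m₁ := by linarith only [hcase, hprem, hsplit]
      have hqm : q * c / 2 ≤ K' * P₂ := by nlinarith only [hm₁, hqpos, hmain]
      have hfin : q * c / (2 * K') ≤ P₂ := by
        rw [div_le_iff₀ (by positivity)]; nlinarith only [hqm, hK'pos]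
      exact (min_le_right _ _).trans hfin


end PocketResampling

/-- **Registered stub `stub_pocketReduction` — THE CERTIFIED REDUCTION (def-free):** a uniform second moment of the
liveness mass at every level (the line's open bet, hypothesis) implies the crux `PercBudgetLadder.PinholeClosing` BY NAME. -/
theorem stub_pocketReduction :
    (∀ (k l : ℕ), 2 ≤ l → ∃ K : ℝ, ∀ n : ℕ, 1 ≤ n →
      ∫ ω, (∑ A ∈ (box 3 (l * n)).powerset,
          {ξ : BondConfig (Site 3) |
          (box 3 n ⊆ A ∧ A ⊆ box 3 (l * n) \ innerBoundary (zdGraph 3) (box 3 (l * n))) ∧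
          ((edgeBoundary (zdGraph 3) A).filter (· ∈ ξ)).card ≤ k + 1 ∧
          ∀ A' : Finset (Site 3), (box 3 n ⊆ A' ∧ A' ⊆ box 3 (l * n) \ innerBoundary (zdGraph 3) (box 3 (l * n))) →
          A' ⊂ A → k + 2 ≤ ((edgeBoundary (zdGraph 3) A').filter (· ∈ ξ)).card}.indicator
          (fun ξ : BondConfig (Site 3) => (bondPercolation (zdGraph 3) (criticalProbI 3)).real
          {ω' : BondConfig (Site 3) |
          (ξ ∩ ↑(edgesTouching (zdGraph 3) A)) ∪ (ω' \ ↑(edgesTouching (zdGraph 3) A)) ∈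
          {ζ : BondConfig (Site 3) | ∃ S : Finset (Sym2 (Site 3)), S.card ≤ k + 1 ∧ ¬ ∃ x ∈ box 3 n,
          ∃ y ∈ innerBoundary (zdGraph 3) (box 3 (l * n)),
          (ζ \ (↑S : Set (Sym2 (Site 3)))) ∈ openConnIn (↑(box 3 (l * n)) : Set (Site 3)) x y} \
          {ζ : BondConfig (Site 3) | ∃ S : Finset (Sym2 (Site 3)), S.card ≤ k ∧ ¬ ∃ x ∈ box 3 n,
          ∃ y ∈ innerBoundary (zdGraph 3) (box 3 (l * n)),
          (ζ \ (↑S : Set (Sym2 (Site 3)))) ∈ openConnIn (↑(box 3 (l * n)) : Set (Site 3)) x y}})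
          ω) ^ 2
        ∂(bondPercolation (zdGraph 3) (criticalProbI 3)) ≤ K) →
    Summit.CriticalPhenomena.PercolationContinuityZ3.Theses.PercBudgetLadder.PinholeClosing :=
  fun h => PocketResampling.pinholeClosing_iff_bEv.2 fun k l c hl hc =>
    PocketResampling.levelStep_of_secondMoment k l c hl hc (h k l hl)

/-- **Registered stub `stub_pocketReductionUI` — the certified reduction, UNIFORM-INTEGRABILITY form (def-free; weaker
hypothesis than `stub_pocketReduction`):** if `∫_{D > K} D ≤ ε` uniformly in `n` at every level, the crux holds BY NAME. -/
theorem stub_pocketReductionUI :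
    (∀ (k l : ℕ), 2 ≤ l → ∀ ε : ℝ, 0 < ε → ∃ K : ℝ, ∀ n : ℕ, 1 ≤ n →
      ∫ ω in {ω : BondConfig (Site 3) | K <
            (∑ A ∈ (box 3 (l * n)).powerset,
              {ξ : BondConfig (Site 3) |
              (box 3 n ⊆ A ∧ A ⊆ box 3 (l * n) \ innerBoundary (zdGraph 3) (box 3 (l * n))) ∧
              ((edgeBoundary (zdGraph 3) A).filter (· ∈ ξ)).card ≤ k + 1 ∧
              ∀ A' : Finset (Site 3), (box 3 n ⊆ A' ∧ A' ⊆ box 3 (l * n) \ innerBoundary (zdGraph 3) (box 3 (l * n))) →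
              A' ⊂ A → k + 2 ≤ ((edgeBoundary (zdGraph 3) A').filter (· ∈ ξ)).card}.indicator
              (fun ξ : BondConfig (Site 3) => (bondPercolation (zdGraph 3) (criticalProbI 3)).real
              {ω' : BondConfig (Site 3) |
              (ξ ∩ ↑(edgesTouching (zdGraph 3) A)) ∪ (ω' \ ↑(edgesTouching (zdGraph 3) A)) ∈
              {ζ : BondConfig (Site 3) | ∃ S : Finset (Sym2 (Site 3)), S.card ≤ k + 1 ∧ ¬ ∃ x ∈ box 3 n,
              ∃ y ∈ innerBoundary (zdGraph 3) (box 3 (l * n)),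
              (ζ \ (↑S : Set (Sym2 (Site 3)))) ∈ openConnIn (↑(box 3 (l * n)) : Set (Site 3)) x y} \
              {ζ : BondConfig (Site 3) | ∃ S : Finset (Sym2 (Site 3)), S.card ≤ k ∧ ¬ ∃ x ∈ box 3 n,
              ∃ y ∈ innerBoundary (zdGraph 3) (box 3 (l * n)),
              (ζ \ (↑S : Set (Sym2 (Site 3)))) ∈ openConnIn (↑(box 3 (l * n)) : Set (Site 3)) x y}})
              ω)},
          (∑ A ∈ (box 3 (l * n)).powerset,
          {ξ : BondConfig (Site 3) |
          (box 3 n ⊆ A ∧ A ⊆ box 3 (l * n) \ innerBoundary (zdGraph 3) (box 3 (l * n))) ∧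
          ((edgeBoundary (zdGraph 3) A).filter (· ∈ ξ)).card ≤ k + 1 ∧
          ∀ A' : Finset (Site 3), (box 3 n ⊆ A' ∧ A' ⊆ box 3 (l * n) \ innerBoundary (zdGraph 3) (box 3 (l * n))) →
          A' ⊂ A → k + 2 ≤ ((edgeBoundary (zdGraph 3) A').filter (· ∈ ξ)).card}.indicator
          (fun ξ : BondConfig (Site 3) => (bondPercolation (zdGraph 3) (criticalProbI 3)).real
          {ω' : BondConfig (Site 3) |
          (ξ ∩ ↑(edgesTouching (zdGraph 3) A)) ∪ (ω' \ ↑(edgesTouching (zdGraph 3) A)) ∈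
          {ζ : BondConfig (Site 3) | ∃ S : Finset (Sym2 (Site 3)), S.card ≤ k + 1 ∧ ¬ ∃ x ∈ box 3 n,
          ∃ y ∈ innerBoundary (zdGraph 3) (box 3 (l * n)),
          (ζ \ (↑S : Set (Sym2 (Site 3)))) ∈ openConnIn (↑(box 3 (l * n)) : Set (Site 3)) x y} \
          {ζ : BondConfig (Site 3) | ∃ S : Finset (Sym2 (Site 3)), S.card ≤ k ∧ ¬ ∃ x ∈ box 3 n,
          ∃ y ∈ innerBoundary (zdGraph 3) (box 3 (l * n)),
          (ζ \ (↑S : Set (Sym2 (Site 3)))) ∈ openConnIn (↑(box 3 (l * n)) : Set (Site 3)) x y}})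
          ω)
        ∂(bondPercolation (zdGraph 3) (criticalProbI 3)) ≤ ε) →
    Summit.CriticalPhenomena.PercolationContinuityZ3.Theses.PercBudgetLadder.PinholeClosing :=
  fun h => PocketResampling.pinholeClosing_iff_bEv.2 fun k l c hl hc =>
    PocketResampling.levelStep_of_uniformIntegrable k l c hl hc (h k l hl)

end Summit.CriticalPhenomena.PercolationContinuityZ3.Theorems
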